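import Summits.BirchSwinnertonDyer.BirchSwinnertonDyer.Theorems.KatoDescentTamePotSupersingularTameLowerFouquetRoadBCS
import Summits.BirchSwinnertonDyer.BirchSwinnertonDyer.Theorems.KatoDescentTamePotSupersingularTameLowerSeedRecordTools
import HarnessLib

/-!
# Route `KatoDescentTamePotSupersingular` (rung K8-t′, cell `bsd-potss`): open core `TameLowerIntrinsicNonCM`
# (item stmt-BirchSwinnertonDyer-19618) — PER-ROW RECORDS 07 of the THIRD seed road `SeedRowC`
# (Fouquet 2025 Thm 4.1 (1)⇒(2) + Burungale–Castella–Skinner 2025 Thm 1.1.2 (b); NO `Ram`, rank or `L`-value condition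
# on the partner) on the CONTENT rows of the cell `L_{II*,5}` (a `--supports … --as helper` file; seat `bsd-potss-k8t-c2`, gen 9)

Rows in this file: `232400cx1` ← `9296a1`, `234650er1` ← `9386n1`, `235200oi1` ← `9408q1`.

For each row `W` (Cremona's minimal model, `N_W = 25·N_G`, additive potentially supersingular TAME (t′) at `5`, Kodaira
`II*`, `v₅(c₄) = 4`; `r_an = 0`, `5 ∣ #Ш_an` — a CONTENT row of the 19618 census) and its congruent partner `G` at
`N_G = N_W/25` (plan g16 `UNITSEED-content-congruentG.tsv`: rank `2`, good ORDINARY at `5`, `ρ̄_{G,5}` onto), the record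
`tameLower_bcs_v<label>` is the SeedRowC road `Theorems.missingLowerBoundAt_rankZero_of_bcsSeed_of_prop4` (p484443)
instantiated: `MissingLowerBoundAt W 5` (L₀ = `ord₅ #Ш_an ≤ ord₅ #Ш`) from
* IN THE KERNEL (`decide` on Cremona's coefficients, tools `Theorems.KTSeedRec.*`): `Δ ≠ 0` and global minimality of
  `W` and `G` (Kraus, factored form; stated as the four theorems `isElliptic_…` / `isGloballyMinimal_…` and taken by the
  record as instance binders); `ρ̄_{W,5}`, `ρ̄_{G,5}` onto (three Serre Prop. 19 witnesses each,
  `Supersingular.surj_of_ainvs_of_serreWitnesses`); `GoodOrd G 5` (`5 ∤ Δ_G`, point count); `FouquetLevelCompatibleAt 5 W G`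
  and `Fouquet2025.Assumption34TateAt 5 W` from the kernel factorisation of `Δ`; Fouquet's Ass. 2.9 (2) EXACTLY
  (`FouquetGenericAt 5 W`: `ΨSq_5` has no root in `ℚ_5`) by two Hensel root censuses of x10b's `RootCensusNewton.check₄`;
* NAMED PUBLISHED INPUTS in hypothesis position: (A′) `Fouquet2025.padicValRat_bsd_rank_zero_of_congruence_of_seedMainIdentity`
  (`hA`), `burungale_castella_skinner_charIdeal_eq_padicLFunction_integral` (`hBCS`), modularity `exists_isNewformOf`
  (`hmodN`), GZK (`hGZK`), Kraus–Oesterlé 1992 Prop. 4 `KrausOesterle1992.prop4_torsionIso_of_congruences` (`hKO`);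
* EVIDENCE binders per row: `r_an(W) = 0` (`hr`, Cremona) and the FINITE Kraus–Oesterlé trace list `hlist` (all primes
  `ℓ < μ(M)/6`: `a_ℓ(W) ≡ a_ℓ(G) (mod 5)` off `N_W N_G`, `a_ℓ a'_ℓ ≡ ℓ + 1` at `ℓ ∥ N_W N_G`) — kit j265271/j265273/j265274/j265275 (tag bsd),
  engines VERBATIM from kt-pdesc g2 (j261046; reused by this seat's g8 j262735): A = `scan.gp` (PARI/GP, sha16
  d3ab08156e6bffa3: mod-5 screen of EVERY Cremona curve at `N_G`, K–O Prop. 4 verbatim on each survivor), B = `engineB.py`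
  (sha16 8f806e99f286370b, PARI-free point counts) re-deriving the verdict; per-pair modulus / bound / prime count in each
  docstring and in `HOME/k8t-c2/g9/SEEDROWC-CENSUS.tsv`.
TIER per row (docstring): `a₅(G)² ≢ 1 (mod 5)` = preprint-free chain (Fouquet Thm 2.10 via Nakamura 2023); `≡ 1` = flag
`@Fouquet-2.10-via-ColmezWang-PRE` (the census' tier B). HONEST LABEL: per-row instances of `SeedRowC`, CONDITIONAL on the
named published inputs; the class-wide statement (Kato's Conj. 12.10 lower inclusion at an additive potentially
supersingular prime) and the items 19618 / 19981 stay OPEN; nothing is booked; BSD is not proved for any curve here.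

References: [Fouquet2025EquivariantTNC] Thm 4.1, Thm 1.7 (2), Ass. 2.9, Ass. 3.4; [BurungaleCastellaSkinner2025] Thm 1.1.2 (b);
[KrausOesterle1992] Prop. 4; [Serre1972] §2.8 Prop. 19; [Kraus1989]; [SilvermanAEC2009] VII.1, VII.5 Prop. 5.1, Ex. 3.7;
[Cremona1997] Table 1; [Miller2011LMS] Def. 1.1.
-/

set_option autoImplicit false
-- sibling precedent (`KatoDescentTamePotSupersingularTameLowerFouquetRoadBCS.lean`): the directory name repeats the summit name
set_option linter.dupNamespace false

noncomputable section

open scoped Classical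

open WeierstrassCurve Literature.NumberTheory.EllipticCurves
  Literature.NumberTheory.EllipticCurves.ModularForms
  Literature.NumberTheory.EllipticCurves.Rank1Residual
  Literature.NumberTheory.EllipticCurves.Rank1Residual.Typed
  Literature.NumberTheory.EllipticCurves.Rank1Residual.X11RankOneCertificates
  Summit.BirchSwinnertonDyer.BirchSwinnertonDyer.Rank1Residual.IntModel
  Summit.BirchSwinnertonDyer.BirchSwinnertonDyer.Rank1Residual.X11RankOne
  Summit.BirchSwinnertonDyer.Rank1Residual.X11b
  Summit.BirchSwinnertonDyer.Rank1Residual.Supersingular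
  Summit.BirchSwinnertonDyer.Rank1Residual.Supersingular.RootCensusNewton
  Summit.BirchSwinnertonDyer.Rank1Residual.Supersingular.LocalOddTorsion
  Summit.BirchSwinnertonDyer.BirchSwinnertonDyer.Theorems

namespace Summit.BirchSwinnertonDyer.BirchSwinnertonDyer.Theorems.KTSeedRowC

/-- `232400cx1` = `[0, 0, 0, -6844375, -6892056250]` (Cremona) has `Δ ≠ 0`. [cite: Cremona1997, Table 1 (label 232400cx1)] -/
theorem isElliptic_v232400cx1 : (⟨0, 0, 0, -6844375, -6892056250⟩ : WeierstrassCurve ℚ).IsElliptic :=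
  isElliptic_of_discOf_ne_zero 0 0 0 (-6844375) (-6892056250) (by decide +kernel)

-- `decide` evaluates `discOf`/`c4Of`/`c6Of` and the Kraus tests on the literal coefficients
set_option maxRecDepth 100000 in
/-- `232400cx1` = `[0, 0, 0, -6844375, -6892056250]` (Cremona) is globally minimal — Kraus' criterion, factored form `|Δ| = 2^8 · 5^10 · 7^4 · 83`, in the kernel.
[cite: Kraus1989, Prop. 1 and Prop. 2] [cite: SilvermanAEC2009, VII.1 Remark 1.1] [cite: Cremona1997, Table 1 (label 232400cx1)] -/
theorem isGloballyMinimal_v232400cx1 : (⟨0, 0, 0, -6844375, -6892056250⟩ : WeierstrassCurve ℚ).IsGloballyMinimal :=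
  isGloballyMinimal_of_krausCriterion₃_factored 0 0 0 (-6844375) (-6892056250) [(2, 8), (5, 10), (7, 4), (83, 1)] (by decide +kernel)
    (by intro qe hqe; fin_cases hqe <;> norm_num) (by decide +kernel)

/-- `9296a1` = `[0, 1, 0, 16, 52]` (Cremona) has `Δ ≠ 0`. [cite: Cremona1997, Table 1 (label 9296a1)] -/
theorem isElliptic_c9296a1 : (⟨0, 1, 0, 16, 52⟩ : WeierstrassCurve ℚ).IsElliptic :=
  isElliptic_of_discOf_ne_zero 0 1 0 16 52 (by decide +kernel)

-- `decide` evaluates `discOf`/`c4Of`/`c6Of` and the Kraus tests on the literal coefficients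
set_option maxRecDepth 100000 in
/-- `9296a1` = `[0, 1, 0, 16, 52]` (Cremona) is globally minimal — Kraus' criterion, factored form `|Δ| = 2^11 · 7 · 83`, in the kernel.
[cite: Kraus1989, Prop. 1 and Prop. 2] [cite: SilvermanAEC2009, VII.1 Remark 1.1] [cite: Cremona1997, Table 1 (label 9296a1)] -/
theorem isGloballyMinimal_c9296a1 : (⟨0, 1, 0, 16, 52⟩ : WeierstrassCurve ℚ).IsGloballyMinimal :=
  isGloballyMinimal_of_krausCriterion₃_factored 0 1 0 16 52 [(2, 11), (7, 1), (83, 1)] (by decide +kernel)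
    (by intro qe hqe; fin_cases hqe <;> norm_num) (by decide +kernel)

-- `decide` evaluates the schema point counts, the supports and the two root censuses on the literal coefficients
set_option maxRecDepth 100000 in
/-- **L₀ = `ord_5 #Ш_an ≤ ord_5 #Ш` for `232400cx1`** (Cremona's minimal model `[0, 0, 0, -6844375, -6892056250]`, `N = 232400 = 25·9296`; additive
potentially supersingular TAME (t′) at `5`, Kodaira `II*` with `v₅(c₄) = 4` (cell `L_{II*,5}`); `r_an = 0`, `#Ш_an = 25` (`ord₅ = 2`),
`∏ c_ℓ = 8`, `#E(ℚ)_tors = 1`; census verdict `SEED-strict` tier A)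
**by the SeedRowC road from the partner `9296a1`** `[0, 1, 0, 16, 52]` (rank `2`, good ORDINARY at `5`: `#G̃(𝔽₅) = 8`, `a₅ = -2`
— `a₅² ≢ 1 (mod 5)`: preprint-free chain, Nakamura 2023; `ρ̄_{G,5}` onto).
IN THE KERNEL: `Δ ≠ 0` and global minimality of both equations (Kraus, factored form: `|Δ_W| = 2^8 · 5^10 · 7^4 · 83`,
`|Δ_G| = 2^11 · 7 · 83`); `ρ̄_{W,5}` and `ρ̄_{G,5}` onto by Serre Prop. 19 witnesses at `ℓ = 17, 3, 3`
(`#W̃ = 15, 1, 1`; `#G̃ = 20, 6, 6`); `GoodOrd G 5`; strict level compatibility (every prime of `Δ_G`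
divides `Δ_W` or is `5`); Ass. 3.4 in Tate form for `W` (no multiplicative prime q with 5 ∣ v_q(Δ_min): vacuous); Ass. 2.9 (2) EXACTLY (`ΨSq_5`
rootless in `ℚ_5`) by the two Hensel root censuses `check₄ 5 prePsi5Z 2 [] ∧ check₄ 5 prePsi5Z.reverse 1 []`.
BINDERS: named facts (A′) `hA`, BCS Thm 1.1.2 (b) `hBCS`, modularity `hmodN`, GZK `hGZK`, Kraus–Oesterlé Prop. 4 `hKO`; the
instances (proved below as `isElliptic_…` / `isGloballyMinimal_…`); Cremona's `r_an = 0` (`hr`); the FINITE K–O trace list `hlist`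
(kit j265271/j265273/j265274/j265275, engines A = PARI `scan.gp` / B = `engineB.py` of kt-pdesc g2 VERBATIM: per-pair bound and prime count in the job's SUMMARY.tsv). Per-row instance of `SeedRowC`; the
class-wide statement and the items stay OPEN; nothing booked; BSD is not proved for this curve by this file.
[cite: Fouquet2025EquivariantTNC, Thm 4.1 (1)⇒(2) (pp. 24–25), Ass. 2.9 (p. 15), Ass. 3.4 (pp. 22–23)] [cite: BurungaleCastellaSkinner2025, Thm 1.1.2 (b)]
[cite: KrausOesterle1992, Prop. 4] [cite: Serre1972, §2.8 Prop. 19] [cite: Cremona1997, Table 1 (labels 232400cx1, 9296a1)] [cite: Miller2011LMS, Def. 1.1] -/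
theorem tameLower_bcs_v232400cx1
    (hA : Fouquet2025.padicValRat_bsd_rank_zero_of_congruence_of_seedMainIdentity)
    (hBCS : burungale_castella_skinner_charIdeal_eq_padicLFunction_integral) (hmodN : exists_isNewformOf)
    (hGZK : rank_eq_analyticRank_of_analyticRank_le_one) (hKO : KrausOesterle1992.prop4_torsionIso_of_congruences)
    (W G : WeierstrassCurve ℚ) [W.IsElliptic] [W.IsGloballyMinimal] [G.IsElliptic] [G.IsGloballyMinimal]
    (hW : W = ⟨0, 0, 0, -6844375, -6892056250⟩) (hG : G = ⟨0, 1, 0, 16, 52⟩) (hr : W.analyticRank = 0)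
    (hlist : ∀ (ℓ : ℕ) [Fact ℓ.Prime],
      6 * ℓ < KrausOesterle1992.gammaZeroIndex (KrausOesterle1992.modulus W G) →
      (padicValNat ℓ (W.conductorNorm ℤ * G.conductorNorm ℤ) = 0 →
          (5 : ℤ) ∣ W.frobeniusTrace ℓ - G.frobeniusTrace ℓ) ∧
        (padicValNat ℓ (W.conductorNorm ℤ * G.conductorNorm ℤ) = 1 →
          (5 : ℤ) ∣ W.frobeniusTrace ℓ * G.frobeniusTrace ℓ - (ℓ + 1))) :
    MissingLowerBoundAt W 5 := by
  subst hW hG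
  have hminW : (⟨0, 0, 0, -6844375, -6892056250⟩ : WeierstrassCurve ℚ).IsGloballyMinimal := inferInstance
  have hminG : (⟨0, 1, 0, 16, 52⟩ : WeierstrassCurve ℚ).IsGloballyMinimal := inferInstance
  have hIW : integralModelInt (⟨0, 0, 0, -6844375, -6892056250⟩ : WeierstrassCurve ℚ) = (⟨0, 0, 0, -6844375, -6892056250⟩ : WeierstrassCurve ℤ) :=
    integralModelInt_eq_of_map_eq _ (map_mk_int 0 0 0 (-6844375) (-6892056250))
  have hIG : integralModelInt (⟨0, 1, 0, 16, 52⟩ : WeierstrassCurve ℚ) = (⟨0, 1, 0, 16, 52⟩ : WeierstrassCurve ℤ) :=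
    integralModelInt_eq_of_map_eq _ (map_mk_int 0 1 0 16 52)
  have hsurjW : Surj (⟨0, 0, 0, -6844375, -6892056250⟩ : WeierstrassCurve ℚ) 5 :=
    @surj_of_ainvs_of_serreWitnesses 0 0 0 (-6844375) (-6892056250) 5 ⟨by norm_num⟩ (by norm_num) hminW
      17 3 3 (by norm_num) (by norm_num) (by norm_num) (by decide) (by decide) (by decide)
      (by decide) (by decide) (by decide) (by decide +kernel) (by decide +kernel) (by decide +kernel)
      (n₁ := 15) (n₂ := 1) (n₃ := 1) (by decide +kernel) (by decide +kernel) (by decide +kernel)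
      (1 : ZMod 5) (3 : ZMod 5) (by decide +kernel) (by decide +kernel) (by decide +kernel)
  have hsurjG : Surj (⟨0, 1, 0, 16, 52⟩ : WeierstrassCurve ℚ) 5 :=
    @surj_of_ainvs_of_serreWitnesses 0 1 0 16 52 5 ⟨by norm_num⟩ (by norm_num) hminG
      17 3 3 (by norm_num) (by norm_num) (by norm_num) (by decide) (by decide) (by decide)
      (by decide) (by decide) (by decide) (by decide +kernel) (by decide +kernel) (by decide +kernel)
      (n₁ := 20) (n₂ := 6) (n₃ := 6) (by decide +kernel) (by decide +kernel) (by decide +kernel)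
      (1 : ZMod 5) (3 : ZMod 5) (by decide +kernel) (by decide +kernel) (by decide +kernel)
  have hordG : GoodOrd (⟨0, 1, 0, 16, 52⟩ : WeierstrassCurve ℚ) 5 :=
    @KTSeedRec.goodOrd_of_countPoints 0 1 0 16 52 5 ⟨by norm_num⟩ (by norm_num) hminG (by decide +kernel) 8
      (by decide +kernel) (by decide)
  have hlev : FouquetLevelCompatibleAt 5 (⟨0, 0, 0, -6844375, -6892056250⟩ : WeierstrassCurve ℚ) (⟨0, 1, 0, 16, 52⟩ : WeierstrassCurve ℚ) :=
    @KTSeedRec.fouquetLevelCompatibleAt_of_factorList 5 ⟨by norm_num⟩ _ _ _ _ _ _ _ _ hIW hIG [(2, 11), (7, 1), (83, 1)]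
      (by intro qe hqe; fin_cases hqe <;> norm_num) (by rw [intCurve_Δ]; decide +kernel)
      (by simp only [intCurve_Δ]; decide +kernel)
  have h34 : Fouquet2025.Assumption34TateAt 5 (⟨0, 0, 0, -6844375, -6892056250⟩ : WeierstrassCurve ℚ) :=
    KTSeedRec.assumption34TateAt_of_factorList 5 hIW [(2, 8), (5, 10), (7, 4), (83, 1)]
      (by intro qe hqe; fin_cases hqe <;> norm_num) (by rw [intCurve_Δ]; decide +kernel)
      (by simp only [intCurve_Δ, intCurve_c₄]; decide +kernel)
  have hgen := KTSeedRec.fouquetGenericAt_five_of_rootCensus 0 0 0 (-6844375) (-6892056250) 2 1 (by decide +kernel)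
    (by decide +kernel)
  haveI : Fact (Nat.Prime 5) := ⟨by norm_num⟩
  exact missingLowerBoundAt_rankZero_of_bcsSeed_of_prop4 _ _ 5 hA hBCS hmodN hGZK hKO (by norm_num) hr hsurjW hgen h34
    hordG hsurjG hlev hlist

/-- `234650er1` = `[1, 1, 1, -1696888, 5435462281]` (Cremona) has `Δ ≠ 0`. [cite: Cremona1997, Table 1 (label 234650er1)] -/
theorem isElliptic_v234650er1 : (⟨1, 1, 1, -1696888, 5435462281⟩ : WeierstrassCurve ℚ).IsElliptic :=
  isElliptic_of_discOf_ne_zero 1 1 1 (-1696888) 5435462281 (by decide +kernel)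

-- `decide` evaluates `discOf`/`c4Of`/`c6Of` and the Kraus tests on the literal coefficients
set_option maxRecDepth 100000 in
/-- `234650er1` = `[1, 1, 1, -1696888, 5435462281]` (Cremona) is globally minimal — Kraus' criterion, factored form `|Δ| = 2^4 · 5^10 · 13 · 19^10`, in the kernel.
[cite: Kraus1989, Prop. 1 and Prop. 2] [cite: SilvermanAEC2009, VII.1 Remark 1.1] [cite: Cremona1997, Table 1 (label 234650er1)] -/
theorem isGloballyMinimal_v234650er1 : (⟨1, 1, 1, -1696888, 5435462281⟩ : WeierstrassCurve ℚ).IsGloballyMinimal :=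
  isGloballyMinimal_of_krausCriterion₃_factored 1 1 1 (-1696888) 5435462281 [(2, 4), (5, 10), (13, 1), (19, 10)] (by decide +kernel)
    (by intro qe hqe; fin_cases hqe <;> norm_num) (by decide +kernel)

/-- `9386n1` = `[1, -1, 1, -87, 4335]` (Cremona) has `Δ ≠ 0`. [cite: Cremona1997, Table 1 (label 9386n1)] -/
theorem isElliptic_c9386n1 : (⟨1, -1, 1, -87, 4335⟩ : WeierstrassCurve ℚ).IsElliptic :=
  isElliptic_of_discOf_ne_zero 1 (-1) 1 (-87) 4335 (by decide +kernel)

-- `decide` evaluates `discOf`/`c4Of`/`c6Of` and the Kraus tests on the literal coefficients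
set_option maxRecDepth 100000 in
/-- `9386n1` = `[1, -1, 1, -87, 4335]` (Cremona) is globally minimal — Kraus' criterion, factored form `|Δ| = 2^17 · 13^2 · 19^2`, in the kernel.
[cite: Kraus1989, Prop. 1 and Prop. 2] [cite: SilvermanAEC2009, VII.1 Remark 1.1] [cite: Cremona1997, Table 1 (label 9386n1)] -/
theorem isGloballyMinimal_c9386n1 : (⟨1, -1, 1, -87, 4335⟩ : WeierstrassCurve ℚ).IsGloballyMinimal :=
  isGloballyMinimal_of_krausCriterion₃_factored 1 (-1) 1 (-87) 4335 [(2, 17), (13, 2), (19, 2)] (by decide +kernel)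
    (by intro qe hqe; fin_cases hqe <;> norm_num) (by decide +kernel)

-- `decide` evaluates the schema point counts, the supports and the two root censuses on the literal coefficients
set_option maxRecDepth 100000 in
/-- **L₀ = `ord_5 #Ш_an ≤ ord_5 #Ш` for `234650er1`** (Cremona's minimal model `[1, 1, 1, -1696888, 5435462281]`, `N = 234650 = 25·9386`; additive
potentially supersingular TAME (t′) at `5`, Kodaira `II*` with `v₅(c₄) = 4` (cell `L_{II*,5}`); `r_an = 0`, `#Ш_an = 25` (`ord₅ = 2`),
`∏ c_ℓ = 4`, `#E(ℚ)_tors = 1`; census verdict `SEED-strict` tier B)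
**by the SeedRowC road from the partner `9386n1`** `[1, -1, 1, -87, 4335]` (rank `2`, good ORDINARY at `5`: `#G̃(𝔽₅) = 10`, `a₅ = -4`
— `a₅² ≡ 1 (mod 5)`: the Fouquet Thm 2.10 input is the Colmez–Wang PREPRINT on this row, flag `@Fouquet-2.10-via-ColmezWang-PRE`; `ρ̄_{G,5}` onto).
IN THE KERNEL: `Δ ≠ 0` and global minimality of both equations (Kraus, factored form: `|Δ_W| = 2^4 · 5^10 · 13 · 19^10`,
`|Δ_G| = 2^17 · 13^2 · 19^2`); `ρ̄_{W,5}` and `ρ̄_{G,5}` onto by Serre Prop. 19 witnesses at `ℓ = 7, 3, 3`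
(`#W̃ = 5, 2, 2`; `#G̃ = 10, 7, 7`); `GoodOrd G 5`; strict level compatibility (every prime of `Δ_G`
divides `Δ_W` or is `5`); Ass. 3.4 in Tate form for `W` (q = 19: 5 ∣ v_q(Δ) = 10 but q ≢ 1 (mod 5)); Ass. 2.9 (2) EXACTLY (`ΨSq_5`
rootless in `ℚ_5`) by the two Hensel root censuses `check₄ 5 prePsi5Z 2 [] ∧ check₄ 5 prePsi5Z.reverse 1 []`.
BINDERS: named facts (A′) `hA`, BCS Thm 1.1.2 (b) `hBCS`, modularity `hmodN`, GZK `hGZK`, Kraus–Oesterlé Prop. 4 `hKO`; the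
instances (proved below as `isElliptic_…` / `isGloballyMinimal_…`); Cremona's `r_an = 0` (`hr`); the FINITE K–O trace list `hlist`
(kit j265271/j265273/j265274/j265275, engines A = PARI `scan.gp` / B = `engineB.py` of kt-pdesc g2 VERBATIM: per-pair bound and prime count in the job's SUMMARY.tsv). Per-row instance of `SeedRowC`; the
class-wide statement and the items stay OPEN; nothing booked; BSD is not proved for this curve by this file.
[cite: Fouquet2025EquivariantTNC, Thm 4.1 (1)⇒(2) (pp. 24–25), Ass. 2.9 (p. 15), Ass. 3.4 (pp. 22–23)] [cite: BurungaleCastellaSkinner2025, Thm 1.1.2 (b)]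
[cite: KrausOesterle1992, Prop. 4] [cite: Serre1972, §2.8 Prop. 19] [cite: Cremona1997, Table 1 (labels 234650er1, 9386n1)] [cite: Miller2011LMS, Def. 1.1] -/
theorem tameLower_bcs_v234650er1
    (hA : Fouquet2025.padicValRat_bsd_rank_zero_of_congruence_of_seedMainIdentity)
    (hBCS : burungale_castella_skinner_charIdeal_eq_padicLFunction_integral) (hmodN : exists_isNewformOf)
    (hGZK : rank_eq_analyticRank_of_analyticRank_le_one) (hKO : KrausOesterle1992.prop4_torsionIso_of_congruences)
    (W G : WeierstrassCurve ℚ) [W.IsElliptic] [W.IsGloballyMinimal] [G.IsElliptic] [G.IsGloballyMinimal]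
    (hW : W = ⟨1, 1, 1, -1696888, 5435462281⟩) (hG : G = ⟨1, -1, 1, -87, 4335⟩) (hr : W.analyticRank = 0)
    (hlist : ∀ (ℓ : ℕ) [Fact ℓ.Prime],
      6 * ℓ < KrausOesterle1992.gammaZeroIndex (KrausOesterle1992.modulus W G) →
      (padicValNat ℓ (W.conductorNorm ℤ * G.conductorNorm ℤ) = 0 →
          (5 : ℤ) ∣ W.frobeniusTrace ℓ - G.frobeniusTrace ℓ) ∧
        (padicValNat ℓ (W.conductorNorm ℤ * G.conductorNorm ℤ) = 1 →
          (5 : ℤ) ∣ W.frobeniusTrace ℓ * G.frobeniusTrace ℓ - (ℓ + 1))) :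
    MissingLowerBoundAt W 5 := by
  subst hW hG
  have hminW : (⟨1, 1, 1, -1696888, 5435462281⟩ : WeierstrassCurve ℚ).IsGloballyMinimal := inferInstance
  have hminG : (⟨1, -1, 1, -87, 4335⟩ : WeierstrassCurve ℚ).IsGloballyMinimal := inferInstance
  have hIW : integralModelInt (⟨1, 1, 1, -1696888, 5435462281⟩ : WeierstrassCurve ℚ) = (⟨1, 1, 1, -1696888, 5435462281⟩ : WeierstrassCurve ℤ) :=
    integralModelInt_eq_of_map_eq _ (map_mk_int 1 1 1 (-1696888) 5435462281)
  have hIG : integralModelInt (⟨1, -1, 1, -87, 4335⟩ : WeierstrassCurve ℚ) = (⟨1, -1, 1, -87, 4335⟩ : WeierstrassCurve ℤ) :=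
    integralModelInt_eq_of_map_eq _ (map_mk_int 1 (-1) 1 (-87) 4335)
  have hsurjW : Surj (⟨1, 1, 1, -1696888, 5435462281⟩ : WeierstrassCurve ℚ) 5 :=
    @surj_of_ainvs_of_serreWitnesses 1 1 1 (-1696888) 5435462281 5 ⟨by norm_num⟩ (by norm_num) hminW
      7 3 3 (by norm_num) (by norm_num) (by norm_num) (by decide) (by decide) (by decide)
      (by decide) (by decide) (by decide) (by decide +kernel) (by decide +kernel) (by decide +kernel)
      (n₁ := 5) (n₂ := 2) (n₃ := 2) (by decide +kernel) (by decide +kernel) (by decide +kernel)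
      (1 : ZMod 5) (3 : ZMod 5) (by decide +kernel) (by decide +kernel) (by decide +kernel)
  have hsurjG : Surj (⟨1, -1, 1, -87, 4335⟩ : WeierstrassCurve ℚ) 5 :=
    @surj_of_ainvs_of_serreWitnesses 1 (-1) 1 (-87) 4335 5 ⟨by norm_num⟩ (by norm_num) hminG
      7 3 3 (by norm_num) (by norm_num) (by norm_num) (by decide) (by decide) (by decide)
      (by decide) (by decide) (by decide) (by decide +kernel) (by decide +kernel) (by decide +kernel)
      (n₁ := 10) (n₂ := 7) (n₃ := 7) (by decide +kernel) (by decide +kernel) (by decide +kernel)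
      (1 : ZMod 5) (3 : ZMod 5) (by decide +kernel) (by decide +kernel) (by decide +kernel)
  have hordG : GoodOrd (⟨1, -1, 1, -87, 4335⟩ : WeierstrassCurve ℚ) 5 :=
    @KTSeedRec.goodOrd_of_countPoints 1 (-1) 1 (-87) 4335 5 ⟨by norm_num⟩ (by norm_num) hminG (by decide +kernel) 10
      (by decide +kernel) (by decide)
  have hlev : FouquetLevelCompatibleAt 5 (⟨1, 1, 1, -1696888, 5435462281⟩ : WeierstrassCurve ℚ) (⟨1, -1, 1, -87, 4335⟩ : WeierstrassCurve ℚ) :=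
    @KTSeedRec.fouquetLevelCompatibleAt_of_factorList 5 ⟨by norm_num⟩ _ _ _ _ _ _ _ _ hIW hIG [(2, 17), (13, 2), (19, 2)]
      (by intro qe hqe; fin_cases hqe <;> norm_num) (by rw [intCurve_Δ]; decide +kernel)
      (by simp only [intCurve_Δ]; decide +kernel)
  have h34 : Fouquet2025.Assumption34TateAt 5 (⟨1, 1, 1, -1696888, 5435462281⟩ : WeierstrassCurve ℚ) :=
    KTSeedRec.assumption34TateAt_of_factorList 5 hIW [(2, 4), (5, 10), (13, 1), (19, 10)]
      (by intro qe hqe; fin_cases hqe <;> norm_num) (by rw [intCurve_Δ]; decide +kernel)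
      (by simp only [intCurve_Δ, intCurve_c₄]; decide +kernel)
  have hgen := KTSeedRec.fouquetGenericAt_five_of_rootCensus 1 1 1 (-1696888) 5435462281 2 1 (by decide +kernel)
    (by decide +kernel)
  haveI : Fact (Nat.Prime 5) := ⟨by norm_num⟩
  exact missingLowerBoundAt_rankZero_of_bcsSeed_of_prop4 _ _ 5 hA hBCS hmodN hGZK hKO (by norm_num) hr hsurjW hgen h34
    hordG hsurjG hlev hlist

/-- `235200oi1` = `[0, -1, 0, -1143333, -562392963]` (Cremona) has `Δ ≠ 0`. [cite: Cremona1997, Table 1 (label 235200oi1)] -/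
theorem isElliptic_v235200oi1 : (⟨0, -1, 0, -1143333, -562392963⟩ : WeierstrassCurve ℚ).IsElliptic :=
  isElliptic_of_discOf_ne_zero 0 (-1) 0 (-1143333) (-562392963) (by decide +kernel)

-- `decide` evaluates `discOf`/`c4Of`/`c6Of` and the Kraus tests on the literal coefficients
set_option maxRecDepth 100000 in
/-- `235200oi1` = `[0, -1, 0, -1143333, -562392963]` (Cremona) is globally minimal — Kraus' criterion, factored form `|Δ| = 2^14 · 3^7 · 5^10 · 7^6`, in the kernel.
[cite: Kraus1989, Prop. 1 and Prop. 2] [cite: SilvermanAEC2009, VII.1 Remark 1.1] [cite: Cremona1997, Table 1 (label 235200oi1)] -/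
theorem isGloballyMinimal_v235200oi1 : (⟨0, -1, 0, -1143333, -562392963⟩ : WeierstrassCurve ℚ).IsGloballyMinimal :=
  isGloballyMinimal_of_krausCriterion₃_factored 0 (-1) 0 (-1143333) (-562392963) [(2, 14), (3, 7), (5, 10), (7, 6)] (by decide +kernel)
    (by intro qe hqe; fin_cases hqe <;> norm_num) (by decide +kernel)

/-- `9408q1` = `[0, -1, 0, 131, -755]` (Cremona) has `Δ ≠ 0`. [cite: Cremona1997, Table 1 (label 9408q1)] -/
theorem isElliptic_c9408q1 : (⟨0, -1, 0, 131, -755⟩ : WeierstrassCurve ℚ).IsElliptic :=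
  isElliptic_of_discOf_ne_zero 0 (-1) 0 131 (-755) (by decide +kernel)

-- `decide` evaluates `discOf`/`c4Of`/`c6Of` and the Kraus tests on the literal coefficients
set_option maxRecDepth 100000 in
/-- `9408q1` = `[0, -1, 0, 131, -755]` (Cremona) is globally minimal — Kraus' criterion, factored form `|Δ| = 2^10 · 3 · 7^6`, in the kernel.
[cite: Kraus1989, Prop. 1 and Prop. 2] [cite: SilvermanAEC2009, VII.1 Remark 1.1] [cite: Cremona1997, Table 1 (label 9408q1)] -/
theorem isGloballyMinimal_c9408q1 : (⟨0, -1, 0, 131, -755⟩ : WeierstrassCurve ℚ).IsGloballyMinimal :=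
  isGloballyMinimal_of_krausCriterion₃_factored 0 (-1) 0 131 (-755) [(2, 10), (3, 1), (7, 6)] (by decide +kernel)
    (by intro qe hqe; fin_cases hqe <;> norm_num) (by decide +kernel)

-- `decide` evaluates the schema point counts, the supports and the two root censuses on the literal coefficients
set_option maxRecDepth 100000 in
/-- **L₀ = `ord_5 #Ш_an ≤ ord_5 #Ш` for `235200oi1`** (Cremona's minimal model `[0, -1, 0, -1143333, -562392963]`, `N = 235200 = 25·9408`; additive
potentially supersingular TAME (t′) at `5`, Kodaira `II*` with `v₅(c₄) = 4` (cell `L_{II*,5}`); `r_an = 0`, `#Ш_an = 25` (`ord₅ = 2`),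
`∏ c_ℓ = 1`, `#E(ℚ)_tors = 1`; census verdict `SEED-strict` tier A)
**by the SeedRowC road from the partner `9408q1`** `[0, -1, 0, 131, -755]` (rank `2`, good ORDINARY at `5`: `#G̃(𝔽₅) = 8`, `a₅ = -2`
— `a₅² ≢ 1 (mod 5)`: preprint-free chain, Nakamura 2023; `ρ̄_{G,5}` onto).
IN THE KERNEL: `Δ ≠ 0` and global minimality of both equations (Kraus, factored form: `|Δ_W| = 2^14 · 3^7 · 5^10 · 7^6`,
`|Δ_G| = 2^10 · 3 · 7^6`); `ρ̄_{W,5}` and `ρ̄_{G,5}` onto by Serre Prop. 19 witnesses at `ℓ = 17, 11, 13`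
(`#W̃ = 20, 6, 11`; `#G̃ = 20, 16, 16`); `GoodOrd G 5`; strict level compatibility (every prime of `Δ_G`
divides `Δ_W` or is `5`); Ass. 3.4 in Tate form for `W` (no multiplicative prime q with 5 ∣ v_q(Δ_min): vacuous); Ass. 2.9 (2) EXACTLY (`ΨSq_5`
rootless in `ℚ_5`) by the two Hensel root censuses `check₄ 5 prePsi5Z 2 [] ∧ check₄ 5 prePsi5Z.reverse 2 []`.
BINDERS: named facts (A′) `hA`, BCS Thm 1.1.2 (b) `hBCS`, modularity `hmodN`, GZK `hGZK`, Kraus–Oesterlé Prop. 4 `hKO`; the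
instances (proved below as `isElliptic_…` / `isGloballyMinimal_…`); Cremona's `r_an = 0` (`hr`); the FINITE K–O trace list `hlist`
(kit j265271/j265273/j265274/j265275, engines A = PARI `scan.gp` / B = `engineB.py` of kt-pdesc g2 VERBATIM: per-pair bound and prime count in the job's SUMMARY.tsv). Per-row instance of `SeedRowC`; the
class-wide statement and the items stay OPEN; nothing booked; BSD is not proved for this curve by this file.
[cite: Fouquet2025EquivariantTNC, Thm 4.1 (1)⇒(2) (pp. 24–25), Ass. 2.9 (p. 15), Ass. 3.4 (pp. 22–23)] [cite: BurungaleCastellaSkinner2025, Thm 1.1.2 (b)]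
[cite: KrausOesterle1992, Prop. 4] [cite: Serre1972, §2.8 Prop. 19] [cite: Cremona1997, Table 1 (labels 235200oi1, 9408q1)] [cite: Miller2011LMS, Def. 1.1] -/
theorem tameLower_bcs_v235200oi1
    (hA : Fouquet2025.padicValRat_bsd_rank_zero_of_congruence_of_seedMainIdentity)
    (hBCS : burungale_castella_skinner_charIdeal_eq_padicLFunction_integral) (hmodN : exists_isNewformOf)
    (hGZK : rank_eq_analyticRank_of_analyticRank_le_one) (hKO : KrausOesterle1992.prop4_torsionIso_of_congruences)
    (W G : WeierstrassCurve ℚ) [W.IsElliptic] [W.IsGloballyMinimal] [G.IsElliptic] [G.IsGloballyMinimal]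
    (hW : W = ⟨0, -1, 0, -1143333, -562392963⟩) (hG : G = ⟨0, -1, 0, 131, -755⟩) (hr : W.analyticRank = 0)
    (hlist : ∀ (ℓ : ℕ) [Fact ℓ.Prime],
      6 * ℓ < KrausOesterle1992.gammaZeroIndex (KrausOesterle1992.modulus W G) →
      (padicValNat ℓ (W.conductorNorm ℤ * G.conductorNorm ℤ) = 0 →
          (5 : ℤ) ∣ W.frobeniusTrace ℓ - G.frobeniusTrace ℓ) ∧
        (padicValNat ℓ (W.conductorNorm ℤ * G.conductorNorm ℤ) = 1 →
          (5 : ℤ) ∣ W.frobeniusTrace ℓ * G.frobeniusTrace ℓ - (ℓ + 1))) :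
    MissingLowerBoundAt W 5 := by
  subst hW hG
  have hminW : (⟨0, -1, 0, -1143333, -562392963⟩ : WeierstrassCurve ℚ).IsGloballyMinimal := inferInstance
  have hminG : (⟨0, -1, 0, 131, -755⟩ : WeierstrassCurve ℚ).IsGloballyMinimal := inferInstance
  have hIW : integralModelInt (⟨0, -1, 0, -1143333, -562392963⟩ : WeierstrassCurve ℚ) = (⟨0, -1, 0, -1143333, -562392963⟩ : WeierstrassCurve ℤ) :=
    integralModelInt_eq_of_map_eq _ (map_mk_int 0 (-1) 0 (-1143333) (-562392963))
  have hIG : integralModelInt (⟨0, -1, 0, 131, -755⟩ : WeierstrassCurve ℚ) = (⟨0, -1, 0, 131, -755⟩ : WeierstrassCurve ℤ) :=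
    integralModelInt_eq_of_map_eq _ (map_mk_int 0 (-1) 0 131 (-755))
  have hsurjW : Surj (⟨0, -1, 0, -1143333, -562392963⟩ : WeierstrassCurve ℚ) 5 :=
    @surj_of_ainvs_of_serreWitnesses 0 (-1) 0 (-1143333) (-562392963) 5 ⟨by norm_num⟩ (by norm_num) hminW
      17 11 13 (by norm_num) (by norm_num) (by norm_num) (by decide) (by decide) (by decide)
      (by decide) (by decide) (by decide) (by decide +kernel) (by decide +kernel) (by decide +kernel)
      (n₁ := 20) (n₂ := 6) (n₃ := 11) (by decide +kernel) (by decide +kernel) (by decide +kernel)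
      (1 : ZMod 5) (3 : ZMod 5) (by decide +kernel) (by decide +kernel) (by decide +kernel)
  have hsurjG : Surj (⟨0, -1, 0, 131, -755⟩ : WeierstrassCurve ℚ) 5 :=
    @surj_of_ainvs_of_serreWitnesses 0 (-1) 0 131 (-755) 5 ⟨by norm_num⟩ (by norm_num) hminG
      17 11 13 (by norm_num) (by norm_num) (by norm_num) (by decide) (by decide) (by decide)
      (by decide) (by decide) (by decide) (by decide +kernel) (by decide +kernel) (by decide +kernel)
      (n₁ := 20) (n₂ := 16) (n₃ := 16) (by decide +kernel) (by decide +kernel) (by decide +kernel)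
      (1 : ZMod 5) (3 : ZMod 5) (by decide +kernel) (by decide +kernel) (by decide +kernel)
  have hordG : GoodOrd (⟨0, -1, 0, 131, -755⟩ : WeierstrassCurve ℚ) 5 :=
    @KTSeedRec.goodOrd_of_countPoints 0 (-1) 0 131 (-755) 5 ⟨by norm_num⟩ (by norm_num) hminG (by decide +kernel) 8
      (by decide +kernel) (by decide)
  have hlev : FouquetLevelCompatibleAt 5 (⟨0, -1, 0, -1143333, -562392963⟩ : WeierstrassCurve ℚ) (⟨0, -1, 0, 131, -755⟩ : WeierstrassCurve ℚ) :=
    @KTSeedRec.fouquetLevelCompatibleAt_of_factorList 5 ⟨by norm_num⟩ _ _ _ _ _ _ _ _ hIW hIG [(2, 10), (3, 1), (7, 6)]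
      (by intro qe hqe; fin_cases hqe <;> norm_num) (by rw [intCurve_Δ]; decide +kernel)
      (by simp only [intCurve_Δ]; decide +kernel)
  have h34 : Fouquet2025.Assumption34TateAt 5 (⟨0, -1, 0, -1143333, -562392963⟩ : WeierstrassCurve ℚ) :=
    KTSeedRec.assumption34TateAt_of_factorList 5 hIW [(2, 14), (3, 7), (5, 10), (7, 6)]
      (by intro qe hqe; fin_cases hqe <;> norm_num) (by rw [intCurve_Δ]; decide +kernel)
      (by simp only [intCurve_Δ, intCurve_c₄]; decide +kernel)
  have hgen := KTSeedRec.fouquetGenericAt_five_of_rootCensus 0 (-1) 0 (-1143333) (-562392963) 2 2 (by decide +kernel)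
    (by decide +kernel)
  haveI : Fact (Nat.Prime 5) := ⟨by norm_num⟩
  exact missingLowerBoundAt_rankZero_of_bcsSeed_of_prop4 _ _ 5 hA hBCS hmodN hGZK hKO (by norm_num) hr hsurjW hgen h34
    hordG hsurjG hlev hlist

end Summit.BirchSwinnertonDyer.BirchSwinnertonDyer.Theorems.KTSeedRowC

end
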